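import Summits.BirchSwinnertonDyer.BirchSwinnertonDyer.Theorems.SignedLowerHalvesBDKimSignedSelmerEqFlatOdd
import Summits.BirchSwinnertonDyer.BirchSwinnertonDyer.Theorems.SignedLowerHalvesBDKimSharpKernelMinus
import HarnessLib

/-!
# B. D. Kim 2013 Cor. 3.15 (`BDKim2013.cor315_signedCharValue_rankZero`, item stmt-BirchSwinnertonDyer-19288 BY NAME) FROM THE
# FOUR GENERIC POITOU–TATE ROWS OVER `ℚ` AND NOTHING ELSE: the `ε = −1` half of TRANSPORT (`Sel⁻(E/ℚ_∞) = Sel♯(E/ℚ_∞)` at an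
# odd supersingular prime with `a_p = 0`, unconditionally) and the final assembly

LADDER-BSD D-0154 (2) INPUTS→UNCONDITIONAL, INPUTS-LIST-2 row F10 (ADDENDUM-5 §C, tranche T2b — CLOSED by this file), seat
`bsd-inputs-kim315-p1` (gen 2); `--supports` stmt-BirchSwinnertonDyer-19288 (`SignedLowerHalves.BDKimSignedCharValueRankZero` =
`SignedBaseChange.BDKimSignedCharValueRankZero` = `PrintX6.InputKimCor315` = the constant `BDKim2013.cor315_signedCharValue_rankZero`).
Sequel and last file of the series `…BDKimSignedCharValueRankZeroOfChromatic` (p618998: Cor. 3.15 ⟸ PT rows + TRANSPORT),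
`…BDKimSignedSelmerEqFlatOdd` (p620294: TRANSPORT at `ε = +1`), `…BDKimMinusCyclicOfHonda` (p620573: CYC⁻),
`…BDKimSharpKernelMinus` (`Ker Col♯ = Ann(⨆ₙ E⁻_n)`, the local minus/`♯` inclusions, `Sel⁻ ≤ Sel♯`).

HONEST FRAMING: THEOREMS ONLY (no definition, no named fact, no instance, no `sorry`). The by-name theorems of §3 are CONDITIONAL
on exactly the four generic class-field-theory duality statements over `ℚ` (Milne ADT I Thm. 4.10 for Selmer structures, 4.10 (a),
4.10 (c) with `r = 3`, Cor. 4.16 — the Literature named facts `poitouTate_selmerStructure_duality ℚ`, `poitouTate_sha_tateDual ℚ`,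
`poitouTate_three_realPlaces_injective ℚ`, `poitouTate_two_realPlaces_surjective ℚ`), which are NOT proved in the tree; item 19288
stays open/held (no unconditional `_holds`); no summit statement is proved; BSD is not proved by any of this. What IS proved
unconditionally: every `±`-specific input of Kim's printed proof (the `±` control theorem at `n = 0`, «`g_v` injective», Thm. 3.14's
consequence `Sel^±_p(E/ℚ_∞)_Γ = 0` in rank `0`, Honda theory, `Sel^± = Sel^{♭/♯}`) is a kernel theorem.

## What is proved (namespace `…Theorems.KimCor315`)

* §1 `signedSelmerInfty_neg_one_eq_sharpFlatSelmerInfty_sharp_odd` — `Sel⁻(E/ℚ_∞) = Sel♯(E/ℚ_∞)` at an odd good `p` with `p ∣ a_p`,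
  cyclotomic `κ`, modulo a TP2-shape Honda system `d`, the base clause (CYC₁) and `g` (odd-`p`, minus twin of
  `signedSelmerInfty_one_eq_sharpFlatSelmerInfty_flat_odd`).
* §2 **`exists_isHondaSystem_signedSelmerInfty_neg_one_eq_sharp`** — TRANSPORT at `ε = −1`, UNCONDITIONAL (primal Honda data of seat
  honda-p1; (CYC₁) from Sprung's level-one relation, `SignedEC.cyc_one_of_gen`); `exists_isHondaSystem_signedSelmerInfty_eq_chromatic`
  — both signs.
* §3 BY NAME: **`cor315_of_cassels_of_poitouTate_rows`** (`CASSELS → PT-Ш → PT3ℝ → PT2ℝ → BDKim2013.cor315_signedCharValue_rankZero`),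
  **`cor315_of_poitouTate_rows`** (`PT-Sel → PT-Ш → PT3ℝ → PT2ℝ → …`), and the three route decls `…_of_poitouTate_rows`.

NET for the input ledger (D-0154 (2)): under item 19288 / F10 the displayed base {Cassels (Greenberg Prop. 4.13), Kim 2013 Thm. 3.14,
Kim's «`g_v` injective»} (p610825) may be replaced by {PT-Sel, PT-Ш, PT3ℝ, PT2ℝ} — the SAME four generic rows as rows 1/7/8.

References: [BDKim2013] Cor. 3.15 (p. 199) and proof (pp. 199–200), Thm. 3.14; [Sprung2012] §1 p. 1486, Thm. 2.2, Lemma 2.3,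
Def. 7.9–7.11; [Kobayashi2003] Def. 1.1, Thm. 6.2, Prop. 8.12, Prop. 8.18–8.23; [GreenbergLNM1716] §4 Prop. 4.13; [MilneADT2006] I
Thm. 4.10, Cor. 4.16, Thm. 6.13; [Cassels1964ArithmeticVII].
-/

set_option autoImplicit false
-- the Theorems namespace of this sub repeats the summit name by design (D-0017 nested layout)
set_option linter.dupNamespace false

noncomputable section

open scoped Classical NumberField

open WeierstrassCurve NumberField IsDedekindDomain Field Literature.NumberTheory.EllipticCurves
  Literature.NumberTheory.GaloisRepresentations Literature.NumberTheory.EllipticCurves.Kobayashi2003 ZpExtension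
  Literature.NumberTheory.EllipticCurves.Sprung2017 Literature.NumberTheory.EllipticCurves.Sprung2012
  Literature.NumberTheory.GaloisCohomology
  Summit.BirchSwinnertonDyer.BirchSwinnertonDyer.Theorems.SignedKatoOffTwo

universe u

namespace Summit.BirchSwinnertonDyer.BirchSwinnertonDyer.Theorems.KimCor315

/-! ## §1 `Sel⁻(E/ℚ_∞) = Sel♯(E/ℚ_∞)` at an odd supersingular prime, modulo a TP2-shape Honda system with (CYC₁) -/

section Odd

variable (W : WeierstrassCurve ℚ) [W.IsElliptic] [W.IsGloballyMinimal] {p : ℕ} [hp : Fact p.Prime]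

/-- **`Sel⁻(E/ℚ_∞) = Sel♯(E/ℚ_∞)` AT AN ODD SUPERSINGULAR PRIME, modulo a TP2-shape Honda system with the base clause (CYC₁).** For
`W/ℚ` globally minimal, `p ≠ 2` good with `p ∣ a_p`, the CYCLOTOMIC `κ`, the place `v ∋ p`, a local lift `g` of the topological generator,
a Honda system `d` of `a_p = 0` shape ((L) (TR) (GEN)) and (CYC₁) `E(ℚ_{1,p}·ℚ_v) = ℤ[Γ]·d_1 + p·E(ℚ_{1,p}·ℚ_v)`: Kobayashi's minus
Selmer group and Sprung's `♯` Selmer group over `ℚ_∞` coincide. (NT) = Sprung's Lemma 2.3, (IDX) = layer degrees; `≤` is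
`SharpKernel.signedSelmerInfty_neg_one_le_sharpFlatSelmerInfty_sharp`, `≥` the local exact-annihilator inclusion + the any-sign descent
`mem_signedSelmerInfty_of_mem_selmerInfty_of_kummer`. [cite: Kobayashi2003, Def. 1.1, Thm. 6.2, Prop. 8.18–8.23]
[cite: Sprung2012, §1 p. 1486, Def. 7.9–7.11 (p. 1503), Lemma 2.3 (p. 1487)] -/
theorem signedSelmerInfty_neg_one_eq_sharpFlatSelmerInfty_sharp_odd (hp2 : p ≠ 2) (hgood : W.HasGoodReductionAtPrime p)
    (hap : (p : ℤ) ∣ W.frobeniusTrace p) (κ : ZpExtension ℚ p) (hκ : κ.IsCyclotomic)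
    (v : HeightOneSpectrum (𝓞 ℚ)) (hv : (p : 𝓞 ℚ) ∈ v.asIdeal)
    {g : Field.absoluteGaloisGroup (v.adicCompletion ℚ)}
    (hg : κ.IsTopGenerator (resGalOfEmb (closureEmb (K := ℚ) (v.adicCompletion ℚ)) g))
    {d : ℕ → localPoints W (v.adicCompletion ℚ)}
    (hd : ∀ m, d m ∈ localLayerPoints κ (v.adicCompletion ℚ) W m)
    (htr : ∀ m, localTrace κ (v.adicCompletion ℚ) W (m + 1) (m + 2) (d (m + 2)) = -d m)
    (hgen : ∀ m : ℕ, 1 ≤ m → ∀ P ∈ localLayerPoints κ (v.adicCompletion ℚ) W m,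
      ∃ B ∈ AddSubgroup.closure (Set.range fun σ : Field.absoluteGaloisGroup (v.adicCompletion ℚ) ↦ σ • d m),
        ∃ P' ∈ localLayerPoints κ (v.adicCompletion ℚ) W (m - 1),
          ∃ R ∈ localLayerPoints κ (v.adicCompletion ℚ) W m, P = B + P' + p • R)
    (hcyc1 : ∀ x ∈ localLayerPoints κ (v.adicCompletion ℚ) W 1,
      ∃ B ∈ AddSubgroup.closure (Set.range fun σ : Field.absoluteGaloisGroup (v.adicCompletion ℚ) ↦ σ • d 1),
        ∃ b ∈ localLayerPoints κ (v.adicCompletion ℚ) W 1, x = B + p • b) :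
    signedSelmerInfty W κ (-1) = sharpFlatSelmerInfty W κ (closureEmb (K := ℚ) (v.adicCompletion ℚ)) 0 g d .sharp := by
  -- (NT): Sprung's Lemma 2.3
  have hnt : ∀ P ∈ localTowerPointsOfEmb κ (closureEmb (K := ℚ) (v.adicCompletion ℚ)) W, p • P = 0 → P = 0 :=
    fun P hP hpP ↦ Sprung2012.eq_zero_of_mem_localTowerPointsOfEmb_of_prime_nsmul W p hp2 hgood hap κ hv _ hP hpP
  refine le_antisymm
    (SharpKernel.signedSelmerInfty_neg_one_le_sharpFlatSelmerInfty_sharp W κ v hv hg hnt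
      (SignedEC.index_subgroupOf_localLayerSubgroupOfEmb_succ_eq hκ v hv) hd htr hgen hcyc1)
    (fun s hs ↦ ?_)
  refine mem_signedSelmerInfty_of_mem_selmerInfty_of_kummer W κ (-1) s
    (sharpFlatSelmerInfty_le_selmerInfty W κ _ 0 g d .sharp hs) fun v' hv' σ ↦ ?_
  obtain rfl : v = v' := heightOneSpectrum_eq_of_natCast_mem hp.out hv (by exact_mod_cast hv')
  exact SharpKernel.conjH1_mem_localKummerOverOfEmb_iSup_minus_of_mem_sharpFlatSelmerInfty W κ _ hg hnt hd htr hs σ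

/-! ## §2 TRANSPORT at `ε = −1` with its Honda system, unconditionally; both signs -/

/-- **TRANSPORT for `ε = −1` at an odd supersingular prime with `a_p = 0` — UNCONDITIONAL.** For `W/ℚ` elliptic, globally minimal,
`p ≠ 2` good with `a_p = 0`, the cyclotomic `κ` and the place `v ∋ p`: there are a local lift `g` of the topological generator, a Honda
system `(cneg, c)` (`IsHondaSystem κ (closureEmb ℚ_v) W a_p g cneg c`, rebuilt from seat honda-p1's primal data) and
`Sel⁻(E/ℚ_∞) = Sel♯(E/ℚ_∞)` for it. (CYC₁) comes from Sprung's level-one relation `Tr_{1/0} c_1 = a_p c_0 − (p−1)c_{−1}`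
(`SignedEC.cyc_one_of_gen`), (GEN) from the multiplier-`N` clause (`gen_of_gen_nsmul`), generation of `E(ℚ_v)` by `c_{−1}` from
`SignedEC.gen_zero_cneg_of_nsmul`. [cite: Sprung2012, §1 p. 1486, Thm. 2.2 (p. 1487), Def. 7.9–7.11]
[cite: Kobayashi2003, Def. 1.1, Thm. 6.2, Prop. 8.12, Prop. 8.18–8.23] -/
theorem exists_isHondaSystem_signedSelmerInfty_neg_one_eq_sharp (hp2 : p ≠ 2) (hgood : W.HasGoodReductionAtPrime p)
    (hap : W.frobeniusTrace p = 0) (κ : ZpExtension ℚ p) (hκ : κ.IsCyclotomic)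
    (v : HeightOneSpectrum (𝓞 ℚ)) (hv : (p : 𝓞 ℚ) ∈ v.asIdeal) :
    ∃ (g : Field.absoluteGaloisGroup (v.adicCompletion ℚ)) (cneg : localPoints W (v.adicCompletion ℚ))
      (c : ℕ → localPoints W (v.adicCompletion ℚ)),
      κ.IsTopGenerator (resGalOfEmb (closureEmb (K := ℚ) (v.adicCompletion ℚ)) g) ∧
      IsHondaSystem κ (closureEmb (K := ℚ) (v.adicCompletion ℚ)) W (W.frobeniusTrace p) g cneg c ∧
      signedSelmerInfty W κ (-1) =
        sharpFlatSelmerInfty W κ (closureEmb (K := ℚ) (v.adicCompletion ℚ)) (W.frobeniusTrace p) g c .sharp := by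
  have hap' : (p : ℤ) ∣ W.frobeniusTrace p := by rw [hap]; exact dvd_zero _
  obtain ⟨g, hg⟩ := ZpExtension.IsCyclotomic.exists_isTopGenerator_resGalOfEmb_adicCompletion hκ v hv
  obtain ⟨cneg, c, N, hN, hcneg, hc, hR0, hR1, hRn, hGEN, hGEN0⟩ :=
    SprungHonda.primalHonda_adicCompletion_of_padic W κ (W.frobeniusTrace p) v hv
      (fun ι ↦ SprungHonda.exists_primalHonda_padic W hp2 hgood hap' κ hκ ι)
  refine ⟨g, cneg, c, hg, SprungHonda.isHondaSystem_of_primal κ (closureEmb (K := ℚ) (v.adicCompletion ℚ)) W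
    (SprungHonda.intCast_sub_two_isUnit_of_dvd hp2 hap').2 hg hN hcneg hc hR0 hR1 hRn hGEN hGEN0, ?_⟩
  -- the TP2-shape clauses for `d := c` at `a_p = 0`, and (CYC₁)
  have htr : ∀ m, localTrace κ (v.adicCompletion ℚ) W (m + 1) (m + 2) (c (m + 2)) = -c m := fun m ↦ by
    have h := hRn (m + 1) (Nat.succ_le_succ (Nat.zero_le m))
    rw [hap, zero_smul, zero_sub, Nat.add_sub_cancel] at h
    exact h
  have hgen := gen_of_gen_nsmul κ (closureEmb (K := ℚ) (v.adicCompletion ℚ)) W hN hGEN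
  have hR1' : localTrace κ (v.adicCompletion ℚ) W 0 1 (c 1) = -(((p : ℤ) - 1) • cneg) := by
    rw [hR1, hap, zero_smul, zero_sub]
  have hcyc1 := SignedEC.cyc_one_of_gen W κ (closureEmb (K := ℚ) (v.adicCompletion ℚ)) hcneg hR1'
    (fun P hP ↦ hgen 1 le_rfl P hP) (SignedEC.gen_zero_cneg_of_nsmul W κ _ hN hGEN0)
  rw [hap]
  exact signedSelmerInfty_neg_one_eq_sharpFlatSelmerInfty_sharp_odd W hp2 hgood hap' κ hκ v hv hg hc htr hgen hcyc1

/-- **TRANSPORT for BOTH signs — the hypothesis `hT` of `cor315_of_poitouTate_of_signedEqChromatic`, discharged**: for every sign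
`ε`, `W/ℚ` globally minimal, `p ≠ 2` good with `a_p = 0`, cyclotomic `κ` and `v ∋ p`, there are `g`, a Honda system `(cneg, c)` and a
colour `col` (`♭` for `ε = 1`, `♯` for `ε = −1`) with `Sel^ε(E/ℚ_∞) = Sel^col(E/ℚ_∞)`. Sprung, J. Number Theory 132 (2012) p. 1486:
at `a_p = 0` the `♯/♭` theory recovers Kobayashi's `∓/±` theory — here as an identity of subgroups of `H¹(ℚ_∞, E[p^∞])`.
[cite: Sprung2012, §1 p. 1486, Thm. 2.2, Def. 7.9–7.11] [cite: Kobayashi2003, Def. 1.1, Thm. 6.2] -/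
theorem exists_isHondaSystem_signedSelmerInfty_eq_chromatic (ε : ℤˣ) (W : WeierstrassCurve ℚ) [W.IsElliptic]
    [W.IsGloballyMinimal] (p : ℕ) [Fact p.Prime] (hp2 : p ≠ 2) (hgood : W.HasGoodReductionAtPrime p)
    (hap : W.frobeniusTrace p = 0) (κ : ZpExtension ℚ p) (hκ : κ.IsCyclotomic)
    (v : HeightOneSpectrum (𝓞 ℚ)) (hv : (p : 𝓞 ℚ) ∈ v.asIdeal) :
    ∃ (g : Field.absoluteGaloisGroup (v.adicCompletion ℚ)) (cneg : localPoints W (v.adicCompletion ℚ))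
      (c : ℕ → localPoints W (v.adicCompletion ℚ)) (col : Chroma),
      κ.IsTopGenerator (resGalOfEmb (closureEmb (K := ℚ) (v.adicCompletion ℚ)) g) ∧
      IsHondaSystem κ (closureEmb (K := ℚ) (v.adicCompletion ℚ)) W (W.frobeniusTrace p) g cneg c ∧
      signedSelmerInfty W κ ε =
        sharpFlatSelmerInfty W κ (closureEmb (K := ℚ) (v.adicCompletion ℚ)) (W.frobeniusTrace p) g c col := by
  rcases Int.units_eq_one_or ε with rfl | rfl
  · obtain ⟨g, cneg, c, hg, hH, heq⟩ := exists_isHondaSystem_signedSelmerInfty_one_eq_flat W hp2 hgood hap κ hκ v hv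
    exact ⟨g, cneg, c, .flat, hg, hH, heq⟩
  · obtain ⟨g, cneg, c, hg, hH, heq⟩ := exists_isHondaSystem_signedSelmerInfty_neg_one_eq_sharp W hp2 hgood hap κ hκ v hv
    exact ⟨g, cneg, c, .sharp, hg, hH, heq⟩

end Odd

/-! ## §3 The Literature fact BY NAME from the four generic Poitou–Tate rows over `ℚ` -/

/-- **B. D. Kim 2013 Cor. 3.15 — the fact `BDKim2013.cor315_signedCharValue_rankZero` — from CASSELS by name (Greenberg Prop. 4.13)
and the three generic Poitou–Tate rows over `ℚ` (Milne I 4.10 (a), 4.10 (c)₃, 4.16), NOTHING ELSE.** TRANSPORT (§2) feeds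
`cor315_of_cassels_of_poitouTate_of_signedEqChromatic`. [cite: BDKim2013, Cor. 3.15 (p. 199) and proof (pp. 199–200)]
[cite: GreenbergLNM1716, §4 Prop. 4.13 (p. 122)] [cite: MilneADT2006, Ch. I, Thm. 4.10 (a),(c), Cor. 4.16] -/
theorem cor315_of_cassels_of_poitouTate_rows (hC : Greenberg1999.casselsSurjectivity_H1Sigma ℚ)
    (hPT : poitouTate_sha_tateDual ℚ) (h3 : poitouTate_three_realPlaces_injective ℚ)
    (h2 : poitouTate_two_realPlaces_surjective ℚ) :
    BDKim2013.cor315_signedCharValue_rankZero :=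
  cor315_of_cassels_of_poitouTate_of_signedEqChromatic hC hPT h3 h2
    fun ε W _ _ p _ hp2 hgood hap κ hκ v hv ↦
      exists_isHondaSystem_signedSelmerInfty_eq_chromatic ε W p hp2 hgood hap κ hκ v hv

/-- **B. D. Kim 2013 Cor. 3.15 — `BDKim2013.cor315_signedCharValue_rankZero` — from the FOUR generic Poitou–Tate rows over `ℚ`**
(`poitouTate_selmerStructure_duality ℚ`, `poitouTate_sha_tateDual ℚ`, `poitouTate_three_realPlaces_injective ℚ`,
`poitouTate_two_realPlaces_surjective ℚ`; CASSELS by `SignedEC.CasselsPT.casselsSurjectivity_H1Sigma_of_poitouTate`). So the by-name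
input F10 of rows 6–8 is CONDITIONAL on exactly the base of rows 1/7/8 and on no `±`-specific statement.
[cite: BDKim2013, Cor. 3.15 (p. 199)] [cite: MilneADT2006, Ch. I, Thm. 4.10, Cor. 4.16, Thm. 6.13, Lemma 6.15]
[cite: Cassels1964ArithmeticVII] -/
theorem cor315_of_poitouTate_rows (hPTs : poitouTate_selmerStructure_duality ℚ)
    (hPT : poitouTate_sha_tateDual ℚ) (h3 : poitouTate_three_realPlaces_injective ℚ)
    (h2 : poitouTate_two_realPlaces_surjective ℚ) :
    BDKim2013.cor315_signedCharValue_rankZero :=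
  cor315_of_cassels_of_poitouTate_rows (SignedEC.CasselsPT.casselsSurjectivity_H1Sigma_of_poitouTate hPTs) hPT h3 h2

/-- **Route `SignedLowerHalves`, support `BDKimSignedCharValueRankZero` (item 19288) ⟸ the four generic Poitou–Tate rows over `ℚ`.**
CONDITIONAL result (the four rows are named facts); the item is not closed. [cite: BDKim2013, Cor. 3.15 (p. 199)]
[cite: MilneADT2006, Ch. I, Thm. 4.10, Cor. 4.16] -/
theorem signedLowerHalves_bdKimSignedCharValueRankZero_of_poitouTate_rows (hPTs : poitouTate_selmerStructure_duality ℚ)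
    (hPT : poitouTate_sha_tateDual ℚ) (h3 : poitouTate_three_realPlaces_injective ℚ)
    (h2 : poitouTate_two_realPlaces_surjective ℚ) :
    Summit.BirchSwinnertonDyer.BirchSwinnertonDyer.Theses.SignedLowerHalves.BDKimSignedCharValueRankZero :=
  cor315_of_poitouTate_rows hPTs hPT h3 h2

/-- **Route `SignedBaseChange`, support `BDKimSignedCharValueRankZero` (item 19288) ⟸ the four generic Poitou–Tate rows over `ℚ`.**
CONDITIONAL result; the item is not closed. [cite: BDKim2013, Cor. 3.15 (p. 199)] [cite: MilneADT2006, Ch. I, Thm. 4.10, Cor. 4.16] -/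
theorem signedBaseChange_bdKimSignedCharValueRankZero_of_poitouTate_rows (hPTs : poitouTate_selmerStructure_duality ℚ)
    (hPT : poitouTate_sha_tateDual ℚ) (h3 : poitouTate_three_realPlaces_injective ℚ)
    (h2 : poitouTate_two_realPlaces_surjective ℚ) :
    Summit.BirchSwinnertonDyer.BirchSwinnertonDyer.Theses.SignedBaseChange.BDKimSignedCharValueRankZero :=
  cor315_of_poitouTate_rows hPTs hPT h3 h2

/-- **Route `PrintX6`, support `InputKimCor315` (item 19288) ⟸ the four generic Poitou–Tate rows over `ℚ`.** CONDITIONAL result; the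
item is not closed. [cite: BDKim2013, Cor. 3.15 (p. 199)] [cite: MilneADT2006, Ch. I, Thm. 4.10, Cor. 4.16] -/
theorem printX6_inputKimCor315_of_poitouTate_rows (hPTs : poitouTate_selmerStructure_duality ℚ)
    (hPT : poitouTate_sha_tateDual ℚ) (h3 : poitouTate_three_realPlaces_injective ℚ)
    (h2 : poitouTate_two_realPlaces_surjective ℚ) :
    Summit.BirchSwinnertonDyer.BirchSwinnertonDyer.Theses.PrintX6.InputKimCor315 :=
  cor315_of_poitouTate_rows hPTs hPT h3 h2

end Summit.BirchSwinnertonDyer.BirchSwinnertonDyer.Theorems.KimCor315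

end
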